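import Summits.PneNP.PneNP.Theorems.KarlinRubinMonotoneSufficesGreedyCircuitSem
import Literature.Computability.Complexity.CircuitClassesProofs
import Literature.Computability.Complexity.CircuitLowerBoundsProofs

/-!
# Crux `MonotoneSuffices` (stmt-PneNP-18026), the GREEDY general detector — part 9b: the layer is a small circuit

Fan-in-2 (`B₂`) straight-line programs, in the `CktSize` calculus of `CircuitComposition`, for the pieces of the
layered trial circuit: big ORs/ANDs of wires allowing empty lists (`cktSize_any_B2`, `cktSize_all_B2`), the
"selected and adjacent" gate (`cktSize_selAdj`), the admission bits `okLevelW` for any finite family of vertices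
(`cktSize_okLevelW`), one layer `layerW c` (`cktSize_layerW`, `≤ tM (tM + t(M+1) + (t+1) + (M+2))` gates) and
the initial wires (`cktSize_initW`). Sizes only; the semantics is part 9a.
-/

set_option linter.dupNamespace false -- `Summit.PneNP.PneNP.…`: summit = sub-problem name (D-0017 single-conjunct layout)

namespace Summit.PneNP.PneNP.Theorems.MonotoneSuffices.Greedy

open Finset
open Literature.Computability.Complexity
open Literature.Probability.RandomGraphs.PlantedClique

variable {ι : Type*} {n t M : ℕ}

/-! ### Big gates over `B₂`, empty lists allowed -/

/-- The OR of a list of wires costs at most `length + 1` gates over `B₂` (a constant if the list is empty).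
[folklore] -/
theorem cktSize_any_B2 (l : List ι) :
    CktSize B2 (fun (x : ι → Bool) (_ : Unit) => l.any fun i => x i) (l.length + 1) := by
  cases l with
  | nil => exact ((cktSize_const ι false).of_le (by simp)).congr fun x _ => by simp
  | cons i l =>
      exact ((cktSize_any (i :: l) (List.cons_ne_nil _ _)).basis_mono
        (monotoneBasis_subset_deMorgan.trans deMorganBasis_subset_B2)).of_le (by simp)

/-- The AND of a list of wires costs at most `length + 1` gates over `B₂` (a constant if the list is empty).
[folklore] -/
theorem cktSize_all_B2 (l : List ι) :
    CktSize B2 (fun (x : ι → Bool) (_ : Unit) => l.all fun i => x i) (l.length + 1) := by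
  cases l with
  | nil => exact ((cktSize_const ι true).of_le (by simp)).congr fun x _ => by simp
  | cons i l =>
      exact ((cktSize_all (i :: l) (List.cons_ne_nil _ _)).basis_mono
        (monotoneBasis_subset_deMorgan.trans deMorganBasis_subset_B2)).of_le (by simp)

/-- The gate `a ∧ ¬ b` costs one gate over `B₂`. [folklore] -/
theorem cktSize_andNot (a b : ι) : CktSize B2 (fun (x : ι → Bool) (_ : Unit) => (x a && ! x b)) 1 :=
  (CktSize.gate (B := B2) (⟨2, fun v => v 0 && ! v 1⟩ : GateFn) (by simp [B2]) ![a, b]).congr fun x _ => by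
    simp

/-! ### "Selected at level `j` and adjacent" -/

/-- The bit `sel(j,m') ∧ adj(v, c j m')` costs one gate (a constant `0` if `v = c j m'`). [folklore] -/
theorem cktSize_selAdj (c : Fin t → Fin M → Fin n) (v : Fin n) (j : Fin t) (m' : Fin M) :
    CktSize B2 (fun (w : (⊤ : SimpleGraph (Fin n)).edgeSet ⊕ (Fin t × Fin M) → Bool) (_ : Unit) =>
      (w (Sum.inr (j, m')) && adjW w v (c j m'))) 1 := by
  by_cases h : v = c j m'
  · refine (cktSize_const _ false).congr fun w _ => ?_
    simp [adjW, h]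
  · refine (cktSize_and (Sum.inr (j, m')) (Sum.inl (edgeOf v (c j m') h))).congr fun w _ => ?_
    simp [adjW, h]

/-- **The admission bits.** For any finite family of vertices `vert : κ → Fin n`, all bits
`okLevelW c w j (vert k)` cost at most `|κ| t M + |κ| t (M+1)` gates. [folklore] -/
theorem cktSize_okLevelW {κ : Type} [Fintype κ] [DecidableEq κ] (c : Fin t → Fin M → Fin n) (vert : κ → Fin n) :
    CktSize B2 (fun (w : (⊤ : SimpleGraph (Fin n)).edgeSet ⊕ (Fin t × Fin M) → Bool) (p : κ × Fin t) =>
        okLevelW c w p.2 (vert p.1))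
      (Fintype.card (κ × Fin t × Fin M) * 1 + Fintype.card (κ × Fin t) * (M + 1)) := by
  -- stage A: all the `sel ∧ adj` bits
  have hA : CktSize B2 (fun (w : (⊤ : SimpleGraph (Fin n)).edgeSet ⊕ (Fin t × Fin M) → Bool)
      (q : κ × Fin t × Fin M) => (w (Sum.inr (q.2.1, q.2.2)) && adjW w (vert q.1) (c q.2.1 q.2.2)))
      (Fintype.card (κ × Fin t × Fin M) * 1) :=
    CktSize.pi_const fun q => cktSize_selAdj c (vert q.1) q.2.1 q.2.2
  -- stage B: OR over the candidate index
  have hB : CktSize B2 (fun (y : κ × Fin t × Fin M → Bool) (p : κ × Fin t) =>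
      ((List.finRange M).map fun m' => (p.1, p.2, m')).any fun q => y q)
      (Fintype.card (κ × Fin t) * (M + 1)) :=
    CktSize.pi_const fun p => by
      have h := cktSize_any_B2 ((List.finRange M).map fun m' => (p.1, p.2, m'))
      rwa [List.length_map, List.length_finRange] at h
  refine (hA.comp hB).congr fun w p => ?_
  apply Bool.eq_iff_iff.2
  simp only [List.any_map, List.any_eq_true, List.mem_finRange, true_and, Function.comp_apply, Bool.and_eq_true,
    okLevelW, decide_eq_true_eq]

/-! ### One layer -/

/-- **One layer is small**: `layerW c` costs at most
`tM·t·M + tM·t·(M+1) + tM·(t+1) + tM·(M+2)` gates (written with `Fintype.card`). [folklore] -/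
theorem cktSize_layerW (c : Fin t → Fin M → Fin n) :
    CktSize B2 (fun (w : (⊤ : SimpleGraph (Fin n)).edgeSet ⊕ (Fin t × Fin M) → Bool) => layerW c w)
      (0 + (Fintype.card ((Fin t × Fin M) × Fin t × Fin M) * 1 + Fintype.card ((Fin t × Fin M) × Fin t) * (M + 1) +
        Fintype.card (Fin t × Fin M) * (t + 1) + Fintype.card (Fin t × Fin M) * (M + 2))) := by
  classical
  -- admission bits of all candidates with respect to all levels
  have hOk := cktSize_okLevelW (κ := Fin t × Fin M) c (fun k => c k.1 k.2)
  -- stage C: in-pool bits (AND over the earlier levels)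
  have hC : CktSize B2 (fun (y : (Fin t × Fin M) × Fin t → Bool) (k : Fin t × Fin M) =>
      (((List.finRange t).filter fun j => j.1 < k.1.1).map fun j => (k, j)).all fun q => y q)
      (Fintype.card (Fin t × Fin M) * (t + 1)) :=
    CktSize.pi_const fun k => by
      have h := cktSize_all_B2 (((List.finRange t).filter fun j => j.1 < k.1.1).map fun j => (k, j))
      refine h.of_le ?_
      rw [List.length_map]
      have := List.length_filter_le (fun j : Fin t => j.1 < k.1.1) (List.finRange t)
      rw [List.length_finRange] at this
      omega
  -- stage D: new selection bits `inPool(i,m) ∧ ¬ OR_{m' < m} inPool(i,m')`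
  have hD : CktSize B2 (fun (z : Fin t × Fin M → Bool) (k : Fin t × Fin M) =>
      (z k && ! ((((List.finRange M).filter fun m' => m'.1 < k.2.1).map fun m' => (k.1, m')).any fun q => z q)))
      (Fintype.card (Fin t × Fin M) * (M + 2)) :=
    CktSize.pi_const fun k => by
      have h1 : CktSize B2 (fun (z : Fin t × Fin M → Bool) (_ : Unit) =>
          (((List.finRange M).filter fun m' => m'.1 < k.2.1).map fun m' => (k.1, m')).any fun q => z q) (M + 1) := by
        have h := cktSize_any_B2 (((List.finRange M).filter fun m' => m'.1 < k.2.1).map fun m' => (k.1, m'))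
        refine h.of_le ?_
        rw [List.length_map]
        have := List.length_filter_le (fun m' : Fin M => m'.1 < k.2.1) (List.finRange M)
        rw [List.length_finRange] at this
        omega
      have h2 := ((CktSize.proj B2 fun _ : Unit => k).pair h1).comp (cktSize_andNot (ι := Unit ⊕ Unit) (Sum.inl ()) (Sum.inr ()))
      exact (h2.of_le (by omega)).congr fun z _ => by simp
  have hNew := (hOk.comp hC).comp hD
  refine ((CktSize.proj B2 fun e : (⊤ : SimpleGraph (Fin n)).edgeSet =>
    (Sum.inl e : (⊤ : SimpleGraph (Fin n)).edgeSet ⊕ (Fin t × Fin M))).pair hNew).congr fun w q => ?_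
  cases q with
  | inl e => rfl
  | inr k =>
      simp only [Sum.elim_inr, layerW_inr]
      -- unfold both sides to the same Boolean expression
      have hin : ∀ v' : Fin M, ((((List.finRange t).filter fun j => j.1 < k.1.1).map fun j => ((k.1, v'), j)).all
          fun q => okLevelW c w q.2 (c q.1.1 q.1.2)) = inPoolW c w k.1 (c k.1 v') := by
        intro v'
        apply Bool.eq_iff_iff.2
        simp only [List.all_map, List.all_eq_true, List.mem_filter, List.mem_finRange, true_and, Function.comp_apply,
          decide_eq_true_eq, inPoolW]
      rw [newSelW]
      obtain ⟨i, m⟩ := k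
      simp only at hin ⊢
      rw [hin m]
      congr 1
      apply Bool.eq_iff_iff.2
      simp only [Bool.not_eq_true', List.any_map, List.any_eq_false, List.mem_filter, List.mem_finRange, true_and,
        Function.comp_apply, decide_eq_true_eq, hin, decide_eq_true_eq, Bool.not_eq_true]

/-! ### The initial wires -/

/-- The initial wires cost `tM` constant gates. [folklore] -/
theorem cktSize_initW (n t M : ℕ) :
    CktSize B2 (fun (x : EdgeVec n) => (initW x : (⊤ : SimpleGraph (Fin n)).edgeSet ⊕ (Fin t × Fin M) → Bool))
      (0 + Fintype.card (Fin t × Fin M) * 1) :=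
  ((CktSize.id B2).pair (CktSize.pi_const fun _ : Fin t × Fin M => cktSize_const _ false)).congr fun x q => by
    cases q <;> rfl

end Summit.PneNP.PneNP.Theorems.MonotoneSuffices.Greedy

namespace Summit.PneNP.PneNP.Theorems.MonotoneSuffices.Greedy

/-- Registered sub-goal `greedy_circuit_size` of stmt-PneNP-18026 (greedy detector, part 9b): the initial wires,
exported verbatim. [folklore] -/
theorem greedy_circuit_size :
    ∀ (n t M : ℕ), Literature.Computability.Complexity.CktSize Literature.Computability.Complexity.B2 (fun (x : Literature.Probability.RandomGraphs.PlantedClique.EdgeVec n) => (Summit.PneNP.PneNP.Theorems.MonotoneSuffices.Greedy.initW x : (⊤ : SimpleGraph (Fin n)).edgeSet ⊕ (Fin t × Fin M) → Bool)) (0 + Fintype.card (Fin t × Fin M) * 1) :=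
  fun n t M => cktSize_initW n t M

end Summit.PneNP.PneNP.Theorems.MonotoneSuffices.Greedy
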